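import Summits.NavierStokesRegularity.NavierStokesRegularity.Theorems.ScenarioCensusSteady
import Summits.NavierStokesRegularity.NavierStokesRegularity.Theorems.SoloSalvageWu2026Closes0897
import Literature.Analysis.FluidPDE.WuSteadyLiouville2026
import Literature.Analysis.FluidPDE.SteadyLiouvilleMeanOscillation
import Summits.NavierStokesRegularity.NavierStokesRegularity.Theorems.PlaneEnergyCeilingSteadyPlanarLiouville
import Summits.NavierStokesRegularity.NavierStokesRegularity.Theorems.DirectionEnergyUntwistedAncientLiouville
import Summits.NavierStokesRegularity.NavierStokesRegularity.Theorems.DirectionDissipationQuantumUnidirectionalAncientLiouville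
import Summits.NavierStokesRegularity.NavierStokesRegularity.Theorems.LocalLambTubeDoorBeltramiWindowRigidityClose
import Summits.NavierStokesRegularity.NavierStokesRegularity.Theorems.LocalOneDirectionTubeDoorOneDirectionWindowRigidityClose
import Summits.NavierStokesRegularity.NavierStokesRegularity.Theorems.LocalVelCompTubeDoorVelCompWindowRigidityClose
import Summits.NavierStokesRegularity.NavierStokesRegularity.Theorems.LocalTraceTubeDoorWindowClose
import Summits.NavierStokesRegularity.NavierStokesRegularity.Theorems.LocalTraceTubeDoorK2Close
import Summits.NavierStokesRegularity.NavierStokesRegularity.Theorems.LocalPlaneStrainDoorK2Close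
import Summits.NavierStokesRegularity.NavierStokesRegularity.Theorems.LocalProductionFreeDoorK2Close
import Summits.NavierStokesRegularity.NavierStokesRegularity.Theorems.LocalPressureProfileDoorMonotonePressureProfileRigidity
import Summits.NavierStokesRegularity.NavierStokesRegularity.Theorems.ImplosionDoorTangentialCurlFreeTriviality
import Summits.NavierStokesRegularity.NavierStokesRegularity.Theorems.ImplosionDoorPassiveRadialVorticity
import Summits.NavierStokesRegularity.NavierStokesRegularity.Theorems.LocalSineTubeDoorProfileAlignedWindowRigidity
import Summits.NavierStokesRegularity.NavierStokesRegularity.Theorems.ClockStretchingLawSteadySliceLiouville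
import Summits.NavierStokesRegularity.NavierStokesRegularity.Theorems.LocalTubeStrainDoorK2Close
import Summits.NavierStokesRegularity.NavierStokesRegularity.Theorems.SymmetryModuliCountRigidComotionVanishesOnEnd
import Summits.NavierStokesRegularity.NavierStokesRegularity.Theorems.SqueezeCycleMustSqueeze
import Summits.NavierStokesRegularity.NavierStokesRegularity.Theorems.ImplosionDoorTarget
import Summits.NavierStokesRegularity.NavierStokesRegularity.Theorems.CorkscrewDynamoSphereTangentLiouville
import Summits.NavierStokesRegularity.NavierStokesRegularity.Theorems.ExtremalTypeIConstantSelfSimilarExcluded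
import Summits.NavierStokesRegularity.NavierStokesRegularity.Theorems.ClockStretchingLawSmallStrainRung
import Summits.NavierStokesRegularity.NavierStokesRegularity.Theorems.QuarterTurnRdssNoSilentTypeIProfile
import Summits.NavierStokesRegularity.NavierStokesRegularity.Theorems.QuarterJoltTypeIJoltLaw
import Summits.NavierStokesRegularity.NavierStokesRegularity.Theorems.TypeIQuarterGateScarEnvelopeTypeINearOneRateDss
import Summits.NavierStokesRegularity.NavierStokesRegularity.Theorems.LerayQuarterDissipationFiniteDissipationLiouvilleVorticityAlignment
import HarnessLib.Audit
import HarnessLib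

/-!
# Blow-up scenario census — CLOSED ITEMS folded BY NAME (rows S5, S1j, S1k, S1m, S1l, A6d, A6c-twin,
# A10c, A10w (1)–(11), A14, A15, F1d-implosion, D7c-sphere, D4-twin)

Cell `pub/ns-census` (`SCENARIO-CENSUS.md` v1.33–v1.35; lead g4 ORDER 11:07Z [1/3] and HANDOFF § lead g4
«v1.36 (a)»: ONE file of census one-liners BY NAME for the rows booked from the refuter's SWEEPs 2–3 of
CLOSED ledger items, values already EXCLUDED-IN-TREE by the lead; S1m stays PRINT).  Pattern of the census
(as `ScenarioCensusRotatingCone.lean`): `Row_<key> : Prop := <the closing item's Theses statement BY NAME>`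
and `theorem row_<key>_excluded : Row_<key> := <the closing theorem BY NAME>` (`closed_by` of the ledger item,
all `proved`, standard axioms per the ref's CHECKs 10:43–10:57Z).  CONED FILE by construction (it imports
one closing Theorems module per item, hence the Theses files of routes GaldiLiouvilleGate, PlaneEnergyCeiling,
DirectionEnergy, DirectionDissipationQuantum, LocalLambTubeDoor, LocalOneDirectionTubeDoor,
LocalVelCompTubeDoor, LocalTraceTubeDoor, LocalPlaneStrainDoor, LocalProductionFreeDoor,
LocalPressureProfileDoor, ImplosionDoor, LocalSineTubeDoor, ClockStretchingLaw, LocalTubeStrainDoor,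
SqueezeCycle, CorkscrewDynamo, ExtremalTypeIConstant, SymmetryModuliCount); nothing cone-free should import
it.  Keys: the lead's (S5, S1j, S1k, S1l, S1m, A6d, A10c, A14, A15) plus sub-keys for the families the census
lists by name (A10w1–A10w11 with 8b = ⟨25305⟩; `A6cTwin` ⟨1923⟩; `F1dImp` ⟨25304⟩; `D7cSph` ⟨1365⟩;
`D4Twin` ⟨8219⟩) — the lead may re-key in the markdown.

No summit statement is proved here; every theorem below is an existing tree theorem cited BY NAME; nothing
in this file is a claim about NS regularity beyond those statements.
-/

noncomputable section

-- the summit and its single problem share the name `NavierStokesRegularity` (D-0017 nested layout)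
set_option linter.dupNamespace false

namespace Summit.NavierStokesRegularity.NavierStokesRegularity.Theorems.ScenarioCensus

open Literature.Analysis Literature.Analysis.FluidPDE
open Summit.NavierStokesRegularity.NavierStokesRegularity.Theorems

/-! ## Block S: Wu 2026 salvage (rows S5, S1j, S1k) and the Coiculescu–Yang print row S1m -/

/-- Row S5 (`Row_S5`, `ScenarioCensusSteady.lean`: steady, Galdi's critical rate, any constants ⇒ `U ≡ 0`,
= item ⟨0897⟩ `GaldiLiouvilleGate.CriticalRateLiouville`) is a theorem of the tree:
`Wu2026Salvage.criticalRateLiouville_proof` (CLOSED proved 2026-08-28).  VALUE FLIP v1.33: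
OPEN-WITH-LINE (conditional) → EXCLUDED-IN-TREE. [cite: Wu2026, Thm. 1.1 and Cor. 1.2 p. 2] -/
theorem row_S5_excluded : Row_S5 := Wu2026Salvage.criticalRateLiouville_proof

/-- **Row S1j** (steady · Wu 2026 Thm 1.1, the vorticity-decay Liouville theorem as typed in the Literature
fact `Wu2026_thm11`): ALIAS BY NAME.  EXCLUDED-IN-TREE. (ref: Wu2026 Thm 1.1) -/
def Row_S1j : Prop := Literature.Analysis.FluidPDE.Wu2026_thm11

/-- Row S1j is a theorem of the tree: `Wu2026Salvage.wu2026_thm11`. [cite: Wu2026, Thm. 1.1 p. 2] -/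
theorem row_S1j_excluded : Row_S1j := Wu2026Salvage.wu2026_thm11

/-- **Row S1k** (steady · Wu 2026 Cor 1.2, as typed in the Literature fact `Wu2026_cor12`): ALIAS BY NAME.
EXCLUDED-IN-TREE. (ref: Wu2026 Cor 1.2) -/
def Row_S1k : Prop := Literature.Analysis.FluidPDE.Wu2026_cor12

/-- Row S1k is a theorem of the tree: `Wu2026Salvage.wu2026_cor12`. [cite: Wu2026, Cor. 1.2 p. 2] -/
theorem row_S1k_excluded : Row_S1k := Wu2026Salvage.wu2026_cor12

/-- **Row S1m** (steady · Coiculescu–Yang 2025 capsule / mean-oscillation Liouville theorem, Thm 1.1 (Liouville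
part) ∧ Thm 1.2, as typed in the Literature named fact `CoiculescuYang2025_capsule_liouville`, lit g7
p625994): ALIAS BY NAME; NOT discharged — EXCLUDED-IN-PRINT-NOT-TREE (no `row_S1m_excluded`).
(ref: CoiculescuYang2025, Thms 1.1–1.2) -/
def Row_S1m : Prop := Literature.Analysis.FluidPDE.CoiculescuYang2025_capsule_liouville

/-! ## Blocks A / F / D: the closed items of the refuter's SWEEPs 2–3 -/

/-- **Row S1l** (steady · bounded smooth steady solution on ℝ³ with bounded planar energies ⇒ `0` (⟨16861⟩; corollary of print: planar energies ⇒ Ṁ^{2,3}, CJLR 2021)): the statement of the CLOSED ledger item BY NAME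
(`Theses.PlaneEnergyCeiling.SteadyPlanarLiouville`).  EXCLUDED-IN-TREE. (ref: tree item; Galdi2011) -/
def Row_S1l : Prop :=
  Summit.NavierStokesRegularity.NavierStokesRegularity.Theses.PlaneEnergyCeiling.SteadyPlanarLiouville

/-- Row S1l is a theorem of the tree: `Theorems.SteadyPlanarLiouville.steadyPlanarLiouville_proof` (the item's `closed_by`). [cite: Galdi2011, §X.9 Remark X.9.4 (the D-solution Liouville problem)] -/
theorem row_S1l_excluded : Row_S1l :=
  Theorems.SteadyPlanarLiouville.steadyPlanarLiouville_proof

/-- **Row A6d** (bounded ancient mild, smooth, vorticity direction locally constant on `{ω ≠ 0}` (untwisted) ⇒ constant slices (⟨2893⟩; Giga–Miura 2011 sub-case in print)): the statement of the CLOSED ledger item BY NAME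
(`Theses.DirectionEnergy.UntwistedAncientLiouville`).  EXCLUDED-IN-TREE. (ref: tree item; KochNadirashviliSereginSverak2009) -/
def Row_A6d : Prop :=
  Summit.NavierStokesRegularity.NavierStokesRegularity.Theses.DirectionEnergy.UntwistedAncientLiouville

/-- Row A6d is a theorem of the tree: `Theorems.directionEnergy_untwistedAncientLiouville_proof` (the item's `closed_by`). [cite: KochNadirashviliSereginSverak2009, Thm 5.1 and §6 (arXiv:0709.3599)] -/
theorem row_A6d_excluded : Row_A6d :=
  Theorems.directionEnergy_untwistedAncientLiouville_proof

/-- **Row A6cTwin** (bounded ancient mild, smooth, `∇v` bounded, `curl v ∥ e` one fixed direction ⇒ constant slices (⟨1923⟩; class twin of row A6c)): the statement of the CLOSED ledger item BY NAME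
(`Theses.DirectionDissipationQuantum.UnidirectionalAncientLiouville`).  EXCLUDED-IN-TREE. (ref: tree item; KochNadirashviliSereginSverak2009) -/
def Row_A6cTwin : Prop :=
  Summit.NavierStokesRegularity.NavierStokesRegularity.Theses.DirectionDissipationQuantum.UnidirectionalAncientLiouville

/-- Row A6cTwin is a theorem of the tree: `Theorems.unidirectionalAncientLiouville_proof` (the item's `closed_by`). [cite: KochNadirashviliSereginSverak2009, Thm 5.1 (arXiv:0709.3599)] -/
theorem row_A6cTwin_excluded : Row_A6cTwin :=
  Theorems.unidirectionalAncientLiouville_proof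

/-- **Row A10c** (Type-I-in-time, continuous, Oseen-mild, divergence-free profile with a BELTRAMI WINDOW (`v × curl v = 0` on a nonempty open set of every slice) ⇒ apex `(0,0)` not backward-singular (⟨19814⟩)): the statement of the CLOSED ledger item BY NAME
(`Theses.LocalLambTubeDoor.BeltramiWindowRigidity`).  EXCLUDED-IN-TREE. (ref: tree item; KochNadirashviliSereginSverak2009) -/
def Row_A10c : Prop :=
  Summit.NavierStokesRegularity.NavierStokesRegularity.Theses.LocalLambTubeDoor.BeltramiWindowRigidity

/-- Row A10c is a theorem of the tree: `Theorems.LocalLambTubeDoorBeltramiWindowRigidityClose.beltramiWindowRigidity_proof` (the item's `closed_by`). [cite: KochNadirashviliSereginSverak2009, §1 (arXiv:0709.3599)] -/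
theorem row_A10c_excluded : Row_A10c :=
  Theorems.LocalLambTubeDoorBeltramiWindowRigidityClose.beltramiWindowRigidity_proof

/-- **Row A10w1** (window-rigidity family (1): `∂ₑv = 0` on a window of every slice ⇒ apex regular (⟨20265⟩)): the statement of the CLOSED ledger item BY NAME
(`Theses.LocalOneDirectionTubeDoor.OneDirectionWindowRigidity`).  EXCLUDED-IN-TREE. (ref: tree item; KochNadirashviliSereginSverak2009) -/
def Row_A10w1 : Prop :=
  Summit.NavierStokesRegularity.NavierStokesRegularity.Theses.LocalOneDirectionTubeDoor.OneDirectionWindowRigidity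

/-- Row A10w1 is a theorem of the tree: `Theorems.LocalOneDirectionTubeDoorOneDirectionWindowRigidityClose.oneDirectionWindowRigidity_proof` (the item's `closed_by`). [cite: KochNadirashviliSereginSverak2009, §1 (arXiv:0709.3599)] -/
theorem row_A10w1_excluded : Row_A10w1 :=
  Theorems.LocalOneDirectionTubeDoorOneDirectionWindowRigidityClose.oneDirectionWindowRigidity_proof

/-- **Row A10w2** (window-rigidity family (2): `⟪v, e⟫ = 0` on a window of every slice ⇒ apex regular (⟨19912⟩)): the statement of the CLOSED ledger item BY NAME
(`Theses.LocalVelCompTubeDoor.VelCompWindowRigidity`).  EXCLUDED-IN-TREE. (ref: tree item; KochNadirashviliSereginSverak2009) -/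
def Row_A10w2 : Prop :=
  Summit.NavierStokesRegularity.NavierStokesRegularity.Theses.LocalVelCompTubeDoor.VelCompWindowRigidity

/-- Row A10w2 is a theorem of the tree: `Theorems.LocalVelCompTubeDoorVelCompWindowRigidityClose.velCompWindowRigidity_proof` (the item's `closed_by`). [cite: KochNadirashviliSereginSverak2009, §1 (arXiv:0709.3599)] -/
theorem row_A10w2_excluded : Row_A10w2 :=
  Theorems.LocalVelCompTubeDoorVelCompWindowRigidityClose.velCompWindowRigidity_proof

/-- **Row A10w3** (window-rigidity family (3): `tr((∇v)²) = 0` on a window of every slice ⇒ apex regular (⟨20415⟩)): the statement of the CLOSED ledger item BY NAME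
(`Theses.LocalTraceTubeDoor.TraceSquareWindowRigidity`).  EXCLUDED-IN-TREE. (ref: tree item; KochNadirashviliSereginSverak2009) -/
def Row_A10w3 : Prop :=
  Summit.NavierStokesRegularity.NavierStokesRegularity.Theses.LocalTraceTubeDoor.TraceSquareWindowRigidity

/-- Row A10w3 is a theorem of the tree: `Theorems.LocalTraceTubeDoorWindowClose.window_proof` (the item's `closed_by`). [cite: KochNadirashviliSereginSverak2009, §1 (arXiv:0709.3599)] -/
theorem row_A10w3_excluded : Row_A10w3 :=
  Theorems.LocalTraceTubeDoorWindowClose.window_proof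

/-- **Row A10w4** (window-rigidity family (4): `tr((∇v)²) = 0` everywhere on every slice ⇒ apex regular (⟨20413⟩)): the statement of the CLOSED ledger item BY NAME
(`Theses.LocalTraceTubeDoor.TraceSquareProfileRigidity`).  EXCLUDED-IN-TREE. (ref: tree item; KochNadirashviliSereginSverak2009) -/
def Row_A10w4 : Prop :=
  Summit.NavierStokesRegularity.NavierStokesRegularity.Theses.LocalTraceTubeDoor.TraceSquareProfileRigidity

/-- Row A10w4 is a theorem of the tree: `Theorems.LocalTraceTubeDoorK2Close.k2_proof` (the item's `closed_by`). [cite: KochNadirashviliSereginSverak2009, §1 (arXiv:0709.3599)] -/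
theorem row_A10w4_excluded : Row_A10w4 :=
  Theorems.LocalTraceTubeDoorK2Close.k2_proof

/-- **Row A10w5** (window-rigidity family (5): `det(∇v + ∇vᵀ) = 0` (plane strain) ⇒ apex regular (⟨20483⟩)): the statement of the CLOSED ledger item BY NAME
(`Theses.LocalPlaneStrainDoor.PlaneStrainProfileRigidity`).  EXCLUDED-IN-TREE. (ref: tree item; KochNadirashviliSereginSverak2009) -/
def Row_A10w5 : Prop :=
  Summit.NavierStokesRegularity.NavierStokesRegularity.Theses.LocalPlaneStrainDoor.PlaneStrainProfileRigidity

/-- Row A10w5 is a theorem of the tree: `Theorems.LocalPlaneStrainDoorK2Close.k2_proof` (the item's `closed_by`). [cite: KochNadirashviliSereginSverak2009, §1 (arXiv:0709.3599)] -/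
theorem row_A10w5_excluded : Row_A10w5 :=
  Theorems.LocalPlaneStrainDoorK2Close.k2_proof

/-- **Row A10w6** (window-rigidity family (6): enstrophy-production density `= 0` ⇒ apex regular (⟨20470⟩)): the statement of the CLOSED ledger item BY NAME
(`Theses.LocalProductionFreeDoor.ProductionFreeProfileRigidity`).  EXCLUDED-IN-TREE. (ref: tree item; KochNadirashviliSereginSverak2009) -/
def Row_A10w6 : Prop :=
  Summit.NavierStokesRegularity.NavierStokesRegularity.Theses.LocalProductionFreeDoor.ProductionFreeProfileRigidity

/-- Row A10w6 is a theorem of the tree: `Theorems.LocalProductionFreeDoorK2Close.k2_proof` (the item's `closed_by`). [cite: KochNadirashviliSereginSverak2009, §1 (arXiv:0709.3599)] -/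
theorem row_A10w6_excluded : Row_A10w6 :=
  Theorems.LocalProductionFreeDoorK2Close.k2_proof

/-- **Row A10w7** (window-rigidity family (7): monotone similarity pressure profile ⇒ apex regular (⟨20180⟩)): the statement of the CLOSED ledger item BY NAME
(`Theses.LocalPressureProfileDoor.MonotonePressureProfileRigidity`).  EXCLUDED-IN-TREE. (ref: tree item; KochNadirashviliSereginSverak2009) -/
def Row_A10w7 : Prop :=
  Summit.NavierStokesRegularity.NavierStokesRegularity.Theses.LocalPressureProfileDoor.MonotonePressureProfileRigidity

/-- Row A10w7 is a theorem of the tree: `Theorems.LocalPressureProfileDoorMonotonePressureProfileRigidity.monotonePressureProfileRigidity_proof` (the item's `closed_by`). [cite: KochNadirashviliSereginSverak2009, §1 (arXiv:0709.3599)] -/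
theorem row_A10w7_excluded : Row_A10w7 :=
  Theorems.LocalPressureProfileDoorMonotonePressureProfileRigidity.monotonePressureProfileRigidity_proof

/-- **Row A10w8** (window-rigidity family (8): slices tangent to spheres with zero radial vorticity ⇒ trivial (⟨25306⟩; the radial-vorticity hypothesis is itself discharged by ⟨25305⟩ `row_A10w8b_excluded`)): the statement of the CLOSED ledger item BY NAME
(`Theses.ImplosionDoor.TangentialCurlFreeTriviality`).  EXCLUDED-IN-TREE. (ref: tree item; KochNadirashviliSereginSverak2009) -/
def Row_A10w8 : Prop :=
  Summit.NavierStokesRegularity.NavierStokesRegularity.Theses.ImplosionDoor.TangentialCurlFreeTriviality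

/-- Row A10w8 is a theorem of the tree: `Theorems.implosionDoor_tangentialCurlFreeTriviality_proof` (the item's `closed_by`). [cite: KochNadirashviliSereginSverak2009, §1 (arXiv:0709.3599)] -/
theorem row_A10w8_excluded : Row_A10w8 :=
  Theorems.implosionDoor_tangentialCurlFreeTriviality_proof

/-- **Row A10w8b** (window-rigidity family (8b): sphere-tangent slices ⇒ radial vorticity `0` (⟨25305⟩, the hypothesis of (8))): the statement of the CLOSED ledger item BY NAME
(`Theses.ImplosionDoor.PassiveRadialVorticity`).  EXCLUDED-IN-TREE. (ref: tree item; KochNadirashviliSereginSverak2009) -/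
def Row_A10w8b : Prop :=
  Summit.NavierStokesRegularity.NavierStokesRegularity.Theses.ImplosionDoor.PassiveRadialVorticity

/-- Row A10w8b is a theorem of the tree: `Theorems.implosionDoor_passiveRadialVorticity_proof` (the item's `closed_by`). [cite: KochNadirashviliSereginSverak2009, §1 (arXiv:0709.3599)] -/
theorem row_A10w8b_excluded : Row_A10w8b :=
  Theorems.implosionDoor_passiveRadialVorticity_proof

/-- **Row A10w9** (window-rigidity family (9): `curl v(−1) × e = 0` on a window of ONE slice ⇒ `v ≡ 0` (⟨20018⟩)): the statement of the CLOSED ledger item BY NAME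
(`Theses.LocalSineTubeDoor.ProfileAlignedWindowRigidity`).  EXCLUDED-IN-TREE. (ref: tree item; KochNadirashviliSereginSverak2009) -/
def Row_A10w9 : Prop :=
  Summit.NavierStokesRegularity.NavierStokesRegularity.Theses.LocalSineTubeDoor.ProfileAlignedWindowRigidity

/-- Row A10w9 is a theorem of the tree: `Theorems.LocalSineTubeDoorProfileAlignedWindowRigidity.profileAlignedWindowRigidity_proof` (the item's `closed_by`). [cite: KochNadirashviliSereginSverak2009, §1 (arXiv:0709.3599)] -/
theorem row_A10w9_excluded : Row_A10w9 :=
  Theorems.LocalSineTubeDoorProfileAlignedWindowRigidity.profileAlignedWindowRigidity_proof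

/-- **Row A10w10** (window-rigidity family (10): ONE steady slice of a smooth KNSS-mild Type-I-in-time ancient solution ⇒ `u ≡ 0` (⟨10572⟩)): the statement of the CLOSED ledger item BY NAME
(`Theses.ClockStretchingLaw.SteadySliceLiouville`).  EXCLUDED-IN-TREE. (ref: tree item; KochNadirashviliSereginSverak2009) -/
def Row_A10w10 : Prop :=
  Summit.NavierStokesRegularity.NavierStokesRegularity.Theses.ClockStretchingLaw.SteadySliceLiouville

/-- Row A10w10 is a theorem of the tree: `Theorems.clockStretchingLaw_steadySliceLiouville_proof` (the item's `closed_by`). [cite: KochNadirashviliSereginSverak2009, §1 (arXiv:0709.3599)] -/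
theorem row_A10w10_excluded : Row_A10w10 :=
  Theorems.clockStretchingLaw_steadySliceLiouville_proof

/-- **Row A10w11** (window-rigidity family (11): middle principal strain `≤ 0` at all `y ≠ 0` of every slice ⇒ apex regular (⟨20493⟩)): the statement of the CLOSED ledger item BY NAME
(`Theses.LocalTubeStrainDoor.TubeStrainProfileRigidity`).  EXCLUDED-IN-TREE. (ref: tree item; KochNadirashviliSereginSverak2009) -/
def Row_A10w11 : Prop :=
  Summit.NavierStokesRegularity.NavierStokesRegularity.Theses.LocalTubeStrainDoor.TubeStrainProfileRigidity

/-- Row A10w11 is a theorem of the tree: `Theorems.LocalTubeStrainDoorK2Close.k2_proof` (the item's `closed_by`). [cite: KochNadirashviliSereginSverak2009, §1 (arXiv:0709.3599)] -/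
theorem row_A10w11_excluded : Row_A10w11 :=
  Theorems.LocalTubeStrainDoorK2Close.k2_proof

/-- **Row A14** (genuine KNSS-gauge Type-I ancient mild `u ∈ A_C` which on a backward END `t < θ` is a RIGID CO-MOTION (annihilated by an extended Killing generator `τ∂ₜ + (a + Ax)·∇ − A`, `τ ≠ 0`, `A` skew) ⇒ `u ≡ 0` (⟨14063⟩; Pineau–Vicol 2026 Rem 1.8 «Killing solitons»)): the statement of the CLOSED ledger item BY NAME
(`Theses.SymmetryModuliCount.RigidComotionVanishesOnEnd`).  EXCLUDED-IN-TREE. (ref: tree item; KochNadirashviliSereginSverak2009) -/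
def Row_A14 : Prop :=
  Summit.NavierStokesRegularity.NavierStokesRegularity.Theses.SymmetryModuliCount.RigidComotionVanishesOnEnd

/-- Row A14 is a theorem of the tree: `Theorems.symmetryModuliCount_rigidComotionVanishesOnEnd_proof` (the item's `closed_by`). [cite: KochNadirashviliSereginSverak2009, §1 conjecture (L) (arXiv:0709.3599)] -/
theorem row_A14_excluded : Row_A14 :=
  Theorems.symmetryModuliCount_rigidComotionVanishesOnEnd_proof

/-- **Row A15** (smooth divergence-free KNSS-mild ancient `u` of the squeeze class `𝒦_C` (`HasTypeITimeDecay C` + two scale-invariant Morrey bounds) whose Leray-gauge middle strain eigenvalue obeys `(−t)·λ₂(∇u) ≤ 1/8` ⇒ `u ≡ 0` (⟨11610⟩; ancient twin of D7cL)): the statement of the CLOSED ledger item BY NAME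
(`Theses.SqueezeCycle.MustSqueeze`).  EXCLUDED-IN-TREE. (ref: tree item; Miller2019) -/
def Row_A15 : Prop :=
  Summit.NavierStokesRegularity.NavierStokesRegularity.Theses.SqueezeCycle.MustSqueeze

/-- Row A15 is a theorem of the tree: `Theorems.squeezeCycle_mustSqueeze_proof` (the item's `closed_by`). [cite: Miller2019, Thm 1.1 (middle eigenvalue of the strain)] -/
theorem row_A15_excluded : Row_A15 :=
  Theorems.squeezeCycle_mustSqueeze_proof

/-- **Row F1dImp** (FORWARD (row F1d + implosion door): Leray–Hopf classical solution with local Type I (ESS) at `(x₀, T)` whose outward radial flux `(max ⟪√(T−t) u, y⟫, 0)²` fades in `L¹` on every similarity ball ⇒ backward bounded at `x₀` (⟨25304⟩, closes K1 ⟨25305⟩ + K2 ⟨25306⟩)): the statement of the CLOSED ledger item BY NAME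
(`Theses.ImplosionDoor.Target`).  EXCLUDED-IN-TREE. (ref: tree item; EscauriazaSereginSverak2003) -/
def Row_F1dImp : Prop :=
  Summit.NavierStokesRegularity.NavierStokesRegularity.Theses.ImplosionDoor.Target

/-- Row F1dImp is a theorem of the tree: `Theorems.ImplosionDoorTarget.target_proof` (the item's `closed_by`). [cite: EscauriazaSereginSverak2003, Thm 1.4 (local Type I / ESS)] -/
theorem row_F1dImp_excluded : Row_F1dImp :=
  Theorems.ImplosionDoorTarget.target_proof

/-- **Row D7cSph** (D7c sub-cell: Type-I rotated-λ-DSS ancient mild (duality class) tangent to spheres `x·u = 0` ⇒ `u = 0` a.e. (⟨1365⟩)): the statement of the CLOSED ledger item BY NAME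
(`Theses.CorkscrewDynamo.SphereTangentLiouville`).  EXCLUDED-IN-TREE. (ref: tree item; Tsai1998) -/
def Row_D7cSph : Prop :=
  Summit.NavierStokesRegularity.NavierStokesRegularity.Theses.CorkscrewDynamo.SphereTangentLiouville

/-- Row D7cSph is a theorem of the tree: `Theorems.sphereTangentLiouville_proof` (the item's `closed_by`). [cite: Tsai1998, Thm 1 (self-similar Liouville)] -/
theorem row_D7cSph_excluded : Row_D7cSph :=
  Theorems.sphereTangentLiouville_proof

/-- **Row D4Twin** (D4 twin inside `A_C`: a KNSS-gauge Type-I ancient mild field self-similar about `(x₁, 0)` vanishes (⟨8219⟩; Tsai 1998 `q = ∞` + KNSS gauge)): the statement of the CLOSED ledger item BY NAME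
(`Theses.ExtremalTypeIConstant.SelfSimilarExcluded`).  EXCLUDED-IN-TREE. (ref: tree item; Tsai1998) -/
def Row_D4Twin : Prop :=
  Summit.NavierStokesRegularity.NavierStokesRegularity.Theses.ExtremalTypeIConstant.SelfSimilarExcluded

/-- Row D4Twin is a theorem of the tree: `Theorems.extremalTypeIConstant_selfSimilarExcluded_proof` (the item's `closed_by`). [cite: Tsai1998, Thm 1] -/
theorem row_D4Twin_excluded : Row_D4Twin :=
  Theorems.extremalTypeIConstant_selfSimilarExcluded_proof

/-! ## Appended 2026-08-28 (typer-1 g4, lead g5 ORDER 11:31Z (3); ref SWEEP 4 11:18Z): rows A2g, A2s -/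

/-- **Row A2g** («small-strain rung», ⟨10574⟩ `ClockStretchingLaw.SmallStrainRung`): the statement of the
CLOSED ledger item BY NAME.  EXCLUDED-IN-TREE (lead g5 v1.36, ref SWEEP 4). (ref: tree item ⟨10574⟩;
KNSS 2009 §1) -/
def Row_A2g : Prop :=
  Summit.NavierStokesRegularity.NavierStokesRegularity.Theses.ClockStretchingLaw.SmallStrainRung

/-- Row A2g is a theorem of the tree: `Theorems.clockStretchingLaw_smallStrainRung_proof` (the item's
`closed_by`). [cite: KochNadirashviliSereginSverak2009, §1 (arXiv:0709.3599)] -/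
theorem row_A2g_excluded : Row_A2g :=
  Theorems.clockStretchingLaw_smallStrainRung_proof

/-- **Row A2s** («silent Type-I profile», ⟨1104⟩ `QuarterTurnRdss.NoSilentTypeIProfile`): the statement of the
CLOSED ledger item BY NAME.  EXCLUDED-IN-TREE (lead g5 v1.36, ref SWEEP 4). (ref: tree item ⟨1104⟩;
KNSS 2009 §1) -/
def Row_A2s : Prop :=
  Summit.NavierStokesRegularity.NavierStokesRegularity.Theses.QuarterTurnRdss.NoSilentTypeIProfile

/-- Row A2s is a theorem of the tree: `Theorems.NoSilentTypeIProfile.quarterTurnRdss_noSilentTypeIProfile_proof`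
(the item's `closed_by`). [cite: KochNadirashviliSereginSverak2009, §1 (arXiv:0709.3599)] -/
theorem row_A2s_excluded : Row_A2s :=
  Theorems.NoSilentTypeIProfile.quarterTurnRdss_noSilentTypeIProfile_proof

/-! ## Appended 2026-08-28 (typer-1 g4, lead g5 NOTE 11:37Z (ii)): row F1j — the Type-I terminal jolt law -/

/-- **Row F1j** (forward · Type I · Clay class, MAXIMAL classical solution on `[0,T)`, Leray–Hopf from a rapidly
decaying datum): the jolt functional `(√(T−t))⁻¹ ∫ ‖u(t) − u(T)‖²` does NOT tend to `0` as `t ↑ T` («every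
Type-I first blow-up jolts») — VERBATIM the statement of `Theorems.NoTerminalJolt.typeI_terminalJoltLaw`
(route QuarterJolt).  EXCLUDED-IN-TREE (a LAW of the hypothetical Type-I blow-up, not an exclusion of it).
(ref: tree theorem; KNSS 2009 §1 Type I) -/
def Row_F1j : Prop :=
  ∀ (ν T : ℝ), 0 < ν → 0 < T →
    ∀ (u : ℝ → EuclideanSpace ℝ (Fin 3) → EuclideanSpace ℝ (Fin 3))
      (p : ℝ → EuclideanSpace ℝ (Fin 3) → ℝ),
    IsMaximalSmoothSolution ν 0 u p T → IsLerayHopfOn T ν 0 (u 0) u → HasRapidSpatialDecay (u 0) →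
    IsTypeIBlowup u T →
      ¬ Filter.Tendsto (fun t : ℝ => (Real.sqrt (T - t))⁻¹ * ∫ x, ‖u t x - u T x‖ ^ 2)
        (nhdsWithin T (Set.Iio T)) (nhds 0)

/-- Row F1j is a theorem of the tree: `Theorems.NoTerminalJolt.typeI_terminalJoltLaw`.
[cite: KochNadirashviliSereginSverak2009, §1 (Type I; arXiv:0709.3599)] -/
theorem row_F1j_excluded : Row_F1j :=
  fun _ _ hν hT _ _ hmax hLH hdec hTI => Theorems.NoTerminalJolt.typeI_terminalJoltLaw hν hT hmax hLH hdec hTI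

/-! ## Appended 2026-08-28 (typer-1 g4, lead g5 ASKS 11:53Z / 12:03Z): rows D5r and A2v -/

/-- **Row D5r** («near-one DSS in the pure time-rate class»): for every Type-I constant `M` there is
`c₁ = c₁(M) > 1` such that a KNSS-gauge Type-I ancient mild field `u ∈ A_M` (`IsTypeIAncientMild M u`; NO
spatial envelope) which is discretely self-similar with factor `c ∈ (1, c₁)` vanishes identically — BY NAME the
rung `NearOneRateDss` of crux ⟨ScarEnvelopeTypeI⟩, line «axis_activity» (route TypeIQuarterGate;
`Theorems/TypeIQuarterGateScarEnvelopeTypeINearOneRateDssAxisActivity.lean` :175).  EXCLUDED-IN-TREE; not in print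
as stated (printed near-one DSS exclusions carry the envelope: Chae–Wolf 2017 Thm 1.3, Pineau–Vicol 2026 Thm 1.6).
(ref: tree rung; ChaeWolf2017 Thm 1.3) -/
def Row_D5r : Prop :=
  Summit.NavierStokesRegularity.NavierStokesRegularity.Cruxes.ScarEnvelopeTypeI.AxisActivity.NearOneRateDss

/-- Row D5r is a theorem of the tree: `Cruxes.ScarEnvelopeTypeI.AxisActivity.nearOneRateDss_proof`
(`Theorems/TypeIQuarterGateScarEnvelopeTypeINearOneRateDss.lean` :132; all former stubs proved).
[cite: ChaeWolf2017RemovingDSS, Thm. 1.3 (the enveloped form in print)] -/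
theorem row_D5r_excluded : Row_D5r :=
  Summit.NavierStokesRegularity.NavierStokesRegularity.Cruxes.ScarEnvelopeTypeI.AxisActivity.nearOneRateDss_proof

/-- **Row A2v** («one-slice vorticity-direction coherence», ancient Type I, finite-dissipation class
`𝒟_{C,K}` = `IsTypeIAncientMild C w` + `∫ ‖∇w(s)‖² ≤ K/√(−s)`): for all `C, K` there is `δ = δ(C,K) > 0` such
that ONE instant `t < 0` at which the vorticity direction is `δ`-coherent MODULO SIGN on the parabolic ball
`B(0, δ⁻¹√(−t))` where `(−t)‖ω(t,·)‖ > δ` forces boundedness on some backward cylinder at the origin (apex not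
singular) — VERBATIM the statement of `FiniteDissipationLiouville.VorticityAlignment.directionCoherence_leaf`
(`Theorems/LerayQuarterDissipationFiniteDissipationLiouvilleVorticityAlignment.lean` :194).  EXCLUDED-IN-TREE;
tree ahead of print (Giga–Miura 2011 needs a space–time modulus of continuity). (ref: tree leaf; GigaMiura2011
Thm 2.10; KNSS 2009 §4) -/
def Row_A2v : Prop :=
  ∀ (C K : ℝ), ∃ δ > 0,
    ∀ (w : ℝ → EuclideanSpace ℝ (Fin 3) → EuclideanSpace ℝ (Fin 3)),
      IsTypeIAncientMild C w →
      (∀ s : ℝ, s < 0 → ∫⁻ x, ‖fderiv ℝ (w s) x‖ₑ ^ 2 ≤ ENNReal.ofReal (K / Real.sqrt (-s))) →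
      (∃ t < 0, ∀ x ∈ Metric.ball (0 : EuclideanSpace ℝ (Fin 3)) (δ⁻¹ * Real.sqrt (-t)),
        ∀ y ∈ Metric.ball (0 : EuclideanSpace ℝ (Fin 3)) (δ⁻¹ * Real.sqrt (-t)),
          δ < (-t) * ‖curl (w t) x‖ → δ < (-t) * ‖curl (w t) y‖ →
          min ‖vorticityDirection (curl (w t)) x - vorticityDirection (curl (w t)) y‖
              ‖vorticityDirection (curl (w t)) x + vorticityDirection (curl (w t)) y‖ ≤ δ) →
      ¬ (∀ ρ > 0, ∀ M : ℝ, ∃ t ∈ Set.Ioo (-(ρ ^ 2)) (0 : ℝ),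
        ∃ x ∈ Metric.ball (0 : EuclideanSpace ℝ (Fin 3)) ρ, M < ‖w t x‖)

/-- Row A2v is a theorem of the tree: `FiniteDissipationLiouville.VorticityAlignment.directionCoherence_leaf`.
[cite: GigaMiura2011, Thm 2.10 (HUPS preprint #956 p. 10)] -/
theorem row_A2v_excluded : Row_A2v :=
  FiniteDissipationLiouville.VorticityAlignment.directionCoherence_leaf

end Summit.NavierStokesRegularity.NavierStokesRegularity.Theorems.ScenarioCensus

end
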